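import Mathlib
import HarnessLib
import Summits.CriticalPhenomena.CardyFormulaZ2.Theorems.CardyMagicRigidityMagicFormulaTPowerSumMoments

/-!
# Line `Sketch` (v10) for crux `MagicFormulaT`, sub-goal AP-3 `ap_expMoment_A3`: uniform-in-mesh
# exponential moments of all orders of the cubic nesting power sum `A₃ = Σ_u θ_u³`

Crux `Summit.CriticalPhenomena.CardyFormulaZ2.Theses.CardyMagicRigidity.MagicFormulaT`
(stmt-CriticalPhenomena-4836), line `Sketch`, skeleton v10, registered sub-goal `ap_expMoment_A3`
(wave 4): for an admissible density `f` (measurable, `|f| ≤ C`, `f = 0` off `B̄(0, R)`, `∫ f = 0`) and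
every real `s` there is `M` with, for all small meshes `δ` (in fact all `0 < δ ≤ 1`),
`E_{1/2} exp(s A₃) ≤ M` (integrability included), where `A₃ = Σ_u θ_u³`, `θ_u = u.nestingPhase f`
over the loops of `siteLoopConfig δ ω` under `triSitePercolation half` (the ensemble `tEns`).  Together
with `ap_expMoment_powerSums` (`A₁`, `A₂`) this completes the a priori bounds for the order-3 limit
passage `E[3A₁³ − 12A₁A₂ + 8A₃] → 0`.

Proof: the pattern of `ap_expMoment_powerSums` with `φ = (·)³`.  Pathwise, by the UV split and AM–GM
(`ap_exp_finsum_le` with `φ x = x³`, `K_φ = K³`, `K = C · Leb(B̄(0,R)) ≥ |θ_u|`,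
`abs_nestingPhase_le_mul_volume_closedBall`),
`exp(s A₃) ≤ ½ exp(2s Θ₃) + ½ exp(2|s| K³ N_b)`, `Θ₃` the inner statistic over `B(0, |R| + 2)` of the
band-restricted cubed phase (band `diam < b`, `b = 1`) and `N_b` the number of loops of diameter `≥ b`
meeting `B̄(0, max R b)`.  Uniformly in `0 < δ ≤ b`: `E exp(2|s| K³ N_b) ≤ C_K` (keystone
`expMoment_ncard_bigLoops_meeting_le_ball`); on the band `|θ_u³| ≤ (πC)³ diam⁶`
(`uva_abs_nestingPhase_le_sq`), hence `≤ (πC)³ b² · diam⁴` (first moment, `stub_bandFirstMoment`: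
`|E Θ₃| ≤ K₁ (πC)³ b² (|R|+2)² b²`) and `≤ (πC)³ b⁴ · diam²` (centred exponential moment,
`stub_bandExpMoment`), so `E exp(2s Θ₃) ≤ e^{2|s| · K₁(πC)³b²(|R|+2)²b²} exp(K₀ (2s)² ((πC)³b⁴)² (|R|+2)³ b)`.
Measurability of `ω ↦ A₃` is `FirstMoment.measurable_finsum_loops`.  No named fact is used; no
definition is introduced.
-/

noncomputable section

namespace Summit.CriticalPhenomena.CardyFormulaZ2.Cruxes.MagicFormulaT.LineSketch

open MeasureTheory Filter Set Metric
open scoped Real Topology BigOperators ENNReal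
open Literature.Probability.RandomPlanarGeometry Literature.Probability.Percolation
  Literature.Probability.LatticeModels
open Summit.CriticalPhenomena.CardyFormulaZ2.Cruxes.NestingRigidity.RingCloudTomography
open Summit.CriticalPhenomena.CardyFormulaZ2.Cruxes.NestingRigidity.PositiveConeWeightDoubling

/-! ## Band dominations of the cubed phase -/

section Phase

variable {f : ℂ → ℝ} {R C : ℝ}

/-- Domination of the band-restricted cubed phase by `(π C)³ · diam⁶` (`|θ_u| ≤ π C diam²`). -/
theorem ap3_band_dom_six (hC : ∀ z, |f z| ≤ C) (hR : ∀ z, R < ‖z‖ → f z = 0) (a b : ℝ)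
    (u : UnbasedLoop ℂ) :
    |(if a ≤ diam u.range ∧ diam u.range < b then u.nestingPhase f ^ 3 else 0)| ≤
      (π * C) ^ 3 * diam u.range ^ 6 := by
  have hC0 : 0 ≤ C := nonneg_of_abs_le hC
  split_ifs
  · rw [abs_pow, show (π * C) ^ 3 * diam u.range ^ 6 = (π * C * diam u.range ^ 2) ^ 3 by ring]
    exact pow_le_pow_left₀ (abs_nonneg _) (uva_abs_nestingPhase_le_sq hC hR u) 3
  · rw [abs_zero]; positivity

/-- On the band `diam < b` the cubed phase is dominated by `(π C)³ b² · diam⁴` (the shape of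
`stub_bandFirstMoment`). -/
theorem ap3_band_dom_four (hC : ∀ z, |f z| ≤ C) (hR : ∀ z, R < ‖z‖ → f z = 0) (a b : ℝ)
    (u : UnbasedLoop ℂ) :
    |(if a ≤ diam u.range ∧ diam u.range < b then u.nestingPhase f ^ 3 else 0)| ≤
      (π * C) ^ 3 * b ^ 2 * diam u.range ^ 4 := by
  have hC0 : 0 ≤ C := nonneg_of_abs_le hC
  by_cases h : a ≤ diam u.range ∧ diam u.range < b
  · calc |(if a ≤ diam u.range ∧ diam u.range < b then u.nestingPhase f ^ 3 else 0)|
          ≤ (π * C) ^ 3 * diam u.range ^ 6 := ap3_band_dom_six hC hR a b u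
      _ = (π * C) ^ 3 * diam u.range ^ 2 * diam u.range ^ 4 := by ring
      _ ≤ (π * C) ^ 3 * b ^ 2 * diam u.range ^ 4 := by
          gcongr _ * ?_ * _
          exact pow_le_pow_left₀ diam_nonneg h.2.le 2
  · rw [if_neg h, abs_zero]; positivity

/-- On the band `diam < b` the cubed phase is dominated by `(π C)³ b⁴ · diam²` (the shape of
`stub_bandExpMoment`). -/
theorem ap3_band_dom_sq (hC : ∀ z, |f z| ≤ C) (hR : ∀ z, R < ‖z‖ → f z = 0) (a b : ℝ)
    (u : UnbasedLoop ℂ) :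
    |(if a ≤ diam u.range ∧ diam u.range < b then u.nestingPhase f ^ 3 else 0)| ≤
      (π * C) ^ 3 * b ^ 4 * diam u.range ^ 2 := by
  have hC0 : 0 ≤ C := nonneg_of_abs_le hC
  by_cases h : a ≤ diam u.range ∧ diam u.range < b
  · calc |(if a ≤ diam u.range ∧ diam u.range < b then u.nestingPhase f ^ 3 else 0)|
          ≤ (π * C) ^ 3 * diam u.range ^ 6 := ap3_band_dom_six hC hR a b u
      _ = (π * C) ^ 3 * (diam u.range ^ 2) ^ 2 * diam u.range ^ 2 := by ring
      _ ≤ (π * C) ^ 3 * (b ^ 2) ^ 2 * diam u.range ^ 2 := by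
          gcongr _ * ?_ * _
          exact pow_le_pow_left₀ (sq_nonneg _) (pow_le_pow_left₀ diam_nonneg h.2.le 2) 2
      _ = (π * C) ^ 3 * b ^ 4 * diam u.range ^ 2 := by ring
  · rw [if_neg h, abs_zero]; positivity

end Phase

/-! ## The registered sub-goal -/

/-- **Sub-goal AP-3 (`ap_expMoment_A3`) · uniform-in-mesh exponential moments of ALL orders of the
cubic nesting power sum** `A₃ = Σ_u θ_u³` (a priori bound for the order-3 limit passage of line
`Sketch` v10): for an admissible density `f` and every real `s` there is `M` with `E exp(s A₃) ≤ M`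
(integrability included), eventually as `δ → 0⁺` (in fact for all `0 < δ ≤ 1`).  UV split at diameter
`b = 1`: big loops by the keystone exponential moments of their number (`|θ_u³| ≤ K³`), small loops
by the band exponential moments of the centred statistic (`|θ_u³| ≤ (πC)³ b⁴ diam²` on the band)
and the band first moments (`|θ_u³| ≤ (πC)³ b² diam⁴`); AM–GM in between.  See the module
docstring. -/
theorem ap_expMoment_A3 : ∀ (f : ℂ → ℝ) (R C : ℝ), Measurable f → (∀ z, |f z| ≤ C) →
    (∀ z, R < ‖z‖ → f z = 0) → ∫ z, f z = 0 → ∀ s : ℝ, ∃ M : ℝ, ∀ᶠ δ in 𝓝[>] (0 : ℝ),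
    Integrable (fun ω ↦ Real.exp (s * ∑ᶠ u ∈ (siteLoopConfig δ ω).loops, u.nestingPhase f ^ 3))
      (triSitePercolation half) ∧
    ∫ ω, Real.exp (s * ∑ᶠ u ∈ (siteLoopConfig δ ω).loops, u.nestingPhase f ^ 3) ∂(triSitePercolation half) ≤ M := by
  intro f R C hf hC hR h0 s
  have hC0 : 0 ≤ C := nonneg_of_abs_le hC
  /- constants attached to `f` and `s` -/
  set κ₁ : ℝ := π * C
  have hκ₁0 : 0 ≤ κ₁ := by positivity
  set K : ℝ := C * volume.real (closedBall (0 : ℂ) R)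
  have hK0 : 0 ≤ K := mul_nonneg hC0 measureReal_nonneg
  have hθK : ∀ u : UnbasedLoop ℂ, |u.nestingPhase f| ≤ K :=
    fun u ↦ abs_nestingPhase_le_mul_volume_closedBall hC hR u
  have hθK3 : ∀ u : UnbasedLoop ℂ, |u.nestingPhase f ^ 3| ≤ K ^ 3 := fun u ↦ by
    rw [abs_pow]; exact pow_le_pow_left₀ (abs_nonneg _) (hθK u) 3
  obtain ⟨b, hb0, hb1⟩ : ∃ b : ℝ, 0 < b ∧ b ≤ 1 := ⟨1, one_pos, le_rfl⟩
  have hbρs : b ≤ |R| + 2 := by linarith [abs_nonneg R]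
  have hκb2 : 0 ≤ κ₁ ^ 3 * b ^ 2 := mul_nonneg (pow_nonneg hκ₁0 3) (pow_nonneg hb0.le 2)
  have hκb4 : 0 ≤ κ₁ ^ 3 * b ^ 4 := mul_nonneg (pow_nonneg hκ₁0 3) (pow_nonneg hb0.le 4)
  set R' : ℝ := max R b
  /- the keystone (big loops) and the band moment constants -/
  obtain ⟨CK, -, hK6⟩ := expMoment_ncard_bigLoops_meeting_le_ball tEns tEns_mem
    (2 * (|s| * K ^ 3)) R' b hb0 (le_max_right _ _)
  obtain ⟨K₀, -, hS1⟩ :=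
    stub_bandExpMoment tEns tEns_mem (|2 * s| * (κ₁ ^ 3 * b ^ 4) * (|R| + 2) ^ 2)
  obtain ⟨K₁, -, hS2⟩ := stub_bandFirstMoment tEns tEns_mem
  set EZ : ℝ := Real.exp (|2 * s| * (K₁ * (κ₁ ^ 3 * b ^ 2) * (|R| + 2) ^ 2 * b ^ 2)) *
    Real.exp (K₀ * (2 * s) ^ 2 * (κ₁ ^ 3 * b ^ 4) ^ 2 * (|R| + 2) ^ 3 * b)
  refine ⟨1 / 2 * EZ + 1 / 2 * CK, ?_⟩
  filter_upwards [Ioc_mem_nhdsGT hb0] with δ ⟨hδ0, hδb⟩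
  /- the statistics at mesh `δ` -/
  set D : Set ℂ := ball (0 : ℂ) (|R| + 2)
  set g3 : UnbasedLoop ℂ → ℝ := fun u ↦
    if 0 ≤ diam u.range ∧ diam u.range < b then u.nestingPhase f ^ 3 else 0
  set Θ₃ : tEns.Ω → ℝ := fun ω ↦ ∑ᶠ u ∈ {u ∈ (tEns.X δ ω).loops | u.range ⊆ D}, g3 u
  set Nb : tEns.Ω → ℕ := fun ω ↦ {u ∈ (tEns.X δ ω).loops |
    (u.range ∩ closedBall (0 : ℂ) R').Nonempty ∧ b ≤ diam u.range}.ncard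
  set A₃ : tEns.Ω → ℝ := fun ω ↦ ∑ᶠ u ∈ (tEns.X δ ω).loops, u.nestingPhase f ^ 3
  /- the pointwise majorant: UV split + AM–GM -/
  have hpt : ∀ ω, Real.exp (s * A₃ ω) ≤ 1 / 2 * Real.exp (2 * s * Θ₃ ω) +
      1 / 2 * Real.exp (2 * (|s| * K ^ 3) * (Nb ω : ℝ)) := fun ω ↦
    ap_exp_finsum_le hR h0 hb1 (le_max_left _ _) (pow_nonneg hK0 3)
      (ConeTilt.finite_loops_meeting tEns tEns_mem hδ0 ω R)
      (ConeTilt.finite_loops_meeting tEns tEns_mem hδ0 ω R') (fun x ↦ x ^ 3) (by norm_num) hθK3 s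
  /- measurability of the power sum -/
  have hmA₃ : Measurable A₃ :=
    FirstMoment.measurable_finsum_loops tEns tEns_mem δ (fun u ↦ u.nestingPhase f ^ 3)
  /- dominations of the band statistic -/
  have hdom4 : ∀ u : UnbasedLoop ℂ, u.range ⊆ D →
      |g3 u| ≤ κ₁ ^ 3 * b ^ 2 * diam u.range ^ 4 := fun u _ ↦ ap3_band_dom_four hC hR 0 b u
  have hdom2 : ∀ u : UnbasedLoop ℂ, u.range ⊆ D →
      |g3 u| ≤ κ₁ ^ 3 * b ^ 4 * diam u.range ^ 2 := fun u _ ↦ ap3_band_dom_sq hC hR 0 b u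
  have hvan : ∀ u : UnbasedLoop ℂ, u.range ⊆ D → b ≤ diam u.range → g3 u = 0 :=
    fun u _ hbu ↦ uva_band_vanish hbu _
  /- the keystone at mesh `δ` -/
  have hK6δ := hK6 0 1 δ one_pos hδ0
  simp only [one_mul] at hK6δ
  /- first and exponential moments of `Θ₃` -/
  have hS2' := hS2 0 (|R| + 2) (κ₁ ^ 3 * b ^ 2) δ b D g3 hδ0 hδb hbρs hκb2 subset_rfl hdom4 hvan
  have hS1z := hS1 0 (|R| + 2) (κ₁ ^ 3 * b ^ 4) (2 * s) δ b D g3 hδ0 hδb hbρs hκb4 subset_rfl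
    hdom2 hvan le_rfl
  set m : ℝ := ∫ ω', (∑ᶠ u ∈ {u ∈ (tEns.X δ ω').loops | u.range ⊆ D}, g3 u) ∂tEns.P
  have hm_le : |m| ≤ K₁ * (κ₁ ^ 3 * b ^ 2) * (|R| + 2) ^ 2 * b ^ 2 :=
    abs_integral_le_integral_abs.trans hS2'.2
  have hexp : ∀ ω, Real.exp (2 * s * Θ₃ ω) =
      Real.exp (2 * s * m) * Real.exp (2 * s * (Θ₃ ω - m)) :=
    fun ω ↦ by rw [← Real.exp_add]; congr 1; ring
  have hIZ : Integrable (fun ω ↦ Real.exp (2 * s * Θ₃ ω)) tEns.P := by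
    simp_rw [hexp]
    exact hS1z.1.const_mul _
  have hEZ : ∫ ω, Real.exp (2 * s * Θ₃ ω) ∂tEns.P ≤ EZ := by
    simp_rw [hexp]
    rw [integral_const_mul]
    refine mul_le_mul (Real.exp_le_exp.2 ?_) hS1z.2 (integral_nonneg fun _ ↦ (Real.exp_pos _).le)
      (Real.exp_pos _).le
    calc 2 * s * m ≤ |2 * s * m| := le_abs_self _
      _ = |2 * s| * |m| := abs_mul _ _
      _ ≤ |2 * s| * (K₁ * (κ₁ ^ 3 * b ^ 2) * (|R| + 2) ^ 2 * b ^ 2) :=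
          mul_le_mul_of_nonneg_left hm_le (abs_nonneg _)
  /- assembly -/
  have hIa : Integrable (fun ω ↦ 1 / 2 * Real.exp (2 * s * Θ₃ ω)) tEns.P := hIZ.const_mul _
  have hIb : Integrable (fun ω ↦ 1 / 2 * Real.exp (2 * (|s| * K ^ 3) * (Nb ω : ℝ))) tEns.P :=
    hK6δ.1.const_mul _
  have hmaj : Integrable (fun ω ↦ 1 / 2 * Real.exp (2 * s * Θ₃ ω) +
      1 / 2 * Real.exp (2 * (|s| * K ^ 3) * (Nb ω : ℝ))) tEns.P := hIa.add hIb
  have hI3 : Integrable (fun ω ↦ Real.exp (s * A₃ ω)) tEns.P :=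
    hmaj.mono' (hmA₃.const_mul s).exp.aestronglyMeasurable (Eventually.of_forall fun ω ↦
      (Real.norm_of_nonneg (Real.exp_pos _).le).trans_le (hpt ω))
  have hE3 : ∫ ω, Real.exp (s * A₃ ω) ∂tEns.P ≤ 1 / 2 * EZ + 1 / 2 * CK := by
    refine (integral_mono hI3 hmaj hpt).trans ?_
    rw [integral_add hIa hIb, integral_const_mul, integral_const_mul]
    exact add_le_add (mul_le_mul_of_nonneg_left hEZ (by norm_num))
      (mul_le_mul_of_nonneg_left hK6δ.2 (by norm_num))
  exact ⟨hI3, hE3⟩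

end Summit.CriticalPhenomena.CardyFormulaZ2.Cruxes.MagicFormulaT.LineSketch

end
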